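import Literature.RingTheory.FittingIdeal.Localization
import Literature.RingTheory.FittingIdeal.Monotone
import Mathlib.AlgebraicGeometry.Morphisms.Finite
import Mathlib.Algebra.Module.LocalizedModule.IsLocalization
import HarnessLib

/-!
# The Fitting ideal sheaves of a finite morphism

Topic: `Literature/AlgebraicGeometry/Morphisms`. For a FINITE morphism `f : X → S` and `r ≥ 0`,
the `r`-th **Fitting ideal sheaf** `Fit_r(f_*𝒪_X) ⊆ 𝒪_S` (Stacks, Tag 0C3C / 0CZ3: the Fitting
ideals of the finite type quasi-coherent `𝒪_S`-module `f_*𝒪_X`): on an affine open `U ⊆ S` its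
ideal of sections is the `r`-th Fitting ideal (Stacks 07Z6, `Literature.RingTheory.FittingIdeal`)
of the finite `Γ(S, U)`-module `Γ(X, f⁻¹U)`. That these ideals form a quasi-coherent ideal sheaf
— `Fit_r` over `Γ(S, D(g))` of `Γ(X, f⁻¹D(g)) = Γ(X, f⁻¹U)[1/g]` is `Fit_r(Γ(X, f⁻¹U)) Γ(S, U)[1/g]`
— is "Fitting ideals commute with localisation" (Stacks 07ZA (3),
`Module.fittingIdeal_of_isLocalizedModule`). These are the centres blown up in Raynaud–Gruson
flattening of finite morphisms (Stacks 0811 / 081R; `StrictTransformFiniteFlattening.lean` for an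
affine base).

* `isLocalization_away_sections_of_eq` — `Γ(X, W)` is `Γ(X, V)[1/t]` for `W = D(t)`, `V` affine
  (transport of Mathlib's `IsAffineOpen.isLocalization_basicOpen` along an equality of opens);
* `finite_app_of_isFinite` — for `f` finite and `U ⊆ S` affine, `Γ(S, U) → Γ(X, f⁻¹U)` is finite;
* `fittingIdeal_sections_basicOpen` — the compatibility with basic opens;
* `Scheme.Hom.fittingIdealSheaf f r` — **the `r`-th Fitting ideal sheaf of `f_*𝒪_X`**, with
  `Scheme.Hom.fittingIdealSheaf_ideal`.

## References

* The Stacks Project, Tag 0C3C (Fitting ideals of finite type quasi-coherent modules),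
  Tag 07ZA, Tag 0811. [StacksProject]
-/

noncomputable section

open CategoryTheory CategoryTheory.Limits AlgebraicGeometry TopologicalSpace

namespace Literature.AlgebraicGeometry.Morphisms

universe u

open Literature.RingTheory.FittingIdeal

/-- `Γ(X, W)` is the localisation `Γ(X, V)[1/t]` when `W = D(t)` for a section `t` over the affine
open `V` (Mathlib's `IsAffineOpen.isLocalization_basicOpen`, transported along the equality of
opens). [folklore] -/
theorem isLocalization_away_sections_of_eq {X : Scheme.{u}} (V : X.affineOpens) (t : Γ(X, V))
    (W : X.Opens) (hW : X.basicOpen t = W) :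
    @IsLocalization.Away _ _ t Γ(X, W) _
      (X.presheaf.map (homOfLE (hW ▸ X.basicOpen_le t : W ≤ V)).op).hom.toAlgebra := by
  subst hW
  exact V.2.isLocalization_basicOpen t

/-- Cancelling a bijective ring map on the left of a finite composite. [folklore] -/
theorem RingHom.Finite.of_bijective_comp {A B C : Type u} [CommRing A] [CommRing B] [CommRing C]
    {φ : A →+* B} {e : B →+* C} (he : Function.Bijective e) (h : (e.comp φ).Finite) : φ.Finite := by
  let e' := RingEquiv.ofBijective e he
  have hφ : φ = e'.symm.toRingHom.comp (e.comp φ) := by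
    ext a
    exact (e'.symm_apply_apply (φ a)).symm
  rw [hφ]
  exact (RingHom.Finite.of_surjective e'.symm.toRingHom e'.symm.surjective).comp h

/-- For a finite morphism `f` and an affine open `U ⊆ S`, the ring map `Γ(S, U) → Γ(X, f⁻¹U)` is
finite. [folklore] -/
theorem finite_app_of_isFinite {X S : Scheme.{u}} (f : X ⟶ S) [IsFinite f] (U : S.affineOpens) :
    (f.app U).hom.Finite := by
  have h : targetAffineLocally (affineAnd @RingHom.Finite) f := by
    rw [show affineAnd @RingHom.Finite =
        fun (X : Scheme.{u}) (_ : Scheme.{u}) (f : X ⟶ _) (_ : IsAffine _) =>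
          IsAffine X ∧ RingHom.Finite f.appTop.hom from rfl,
      ← HasAffineProperty.eq_targetAffineLocally (P := @IsFinite)]
    infer_instance
  rw [targetAffineLocally_affineAnd_iff RingHom.finite_respectsIso] at h
  exact (h U U.2).2

section Sheaf

variable {X S : Scheme.{u}} (f : X ⟶ S) [IsFinite f]

/-- **Fitting ideals of sections commute with basic opens**: for `f` finite, `U ⊆ S` affine and
`g ∈ Γ(S, U)`, the `r`-th Fitting ideal over `Γ(S, D(g))` of `Γ(X, f⁻¹D(g))` is the extension of
the `r`-th Fitting ideal over `Γ(S, U)` of `Γ(X, f⁻¹U)` (Stacks 07ZA (3): `Γ(X, f⁻¹D(g))` is the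
localisation of `Γ(X, f⁻¹U)` at `g`). [cite: StacksProject, Tag 07ZA] -/
theorem fittingIdeal_sections_basicOpen (U : S.affineOpens) (g : Γ(S, U)) (r : ℕ) :
    (letI := (f.app (S.basicOpen g)).hom.toAlgebra;
      Module.fittingIdeal Γ(S, S.basicOpen g) Γ(X, f ⁻¹ᵁ S.basicOpen g) r) =
      (letI := (f.app (U : S.Opens)).hom.toAlgebra;
        Module.fittingIdeal Γ(S, U) Γ(X, f ⁻¹ᵁ (U : S.Opens)) r).map
        (S.presheaf.map (homOfLE (S.basicOpen_le g)).op).hom := by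
  -- the rings and modules
  letI algA : Algebra Γ(S, U) Γ(X, f ⁻¹ᵁ (U : S.Opens)) := (f.app (U : S.Opens)).hom.toAlgebra
  have hWV : f ⁻¹ᵁ S.basicOpen g ≤ f ⁻¹ᵁ (U : S.Opens) := (f.preimage_mono (S.basicOpen_le g))
  letI algAAg : Algebra Γ(X, f ⁻¹ᵁ (U : S.Opens)) Γ(X, f ⁻¹ᵁ S.basicOpen g) :=
    (X.presheaf.map (homOfLE hWV).op).hom.toAlgebra
  letI algRAg : Algebra Γ(S, U) Γ(X, f ⁻¹ᵁ S.basicOpen g) :=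
    ((X.presheaf.map (homOfLE hWV).op).hom.comp (f.app (U : S.Opens)).hom).toAlgebra
  haveI towerRAAg : IsScalarTower Γ(S, U) Γ(X, f ⁻¹ᵁ (U : S.Opens)) Γ(X, f ⁻¹ᵁ S.basicOpen g) :=
    IsScalarTower.of_algebraMap_eq fun _ => rfl
  letI algRgAg : Algebra Γ(S, S.basicOpen g) Γ(X, f ⁻¹ᵁ S.basicOpen g) :=
    (f.app (S.basicOpen g)).hom.toAlgebra
  haveI towerRRgAg : IsScalarTower Γ(S, U) Γ(S, S.basicOpen g) Γ(X, f ⁻¹ᵁ S.basicOpen g) := by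
    refine IsScalarTower.of_algebraMap_eq fun a => ?_
    change (X.presheaf.map (homOfLE hWV).op) (f.app (U : S.Opens) a) =
      f.app (S.basicOpen g) (S.presheaf.map (homOfLE (S.basicOpen_le g)).op a)
    rw [← CommRingCat.comp_apply, ← CommRingCat.comp_apply, f.naturality]
    rfl
  haveI : Module.Finite Γ(S, U) Γ(X, f ⁻¹ᵁ (U : S.Opens)) := finite_app_of_isFinite f U
  -- `Γ(X, f⁻¹D(g))` is the localisation of `Γ(X, f⁻¹U)` at `g`
  have hloc : IsLocalization.Away (f.app (U : S.Opens) g) Γ(X, f ⁻¹ᵁ S.basicOpen g) :=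
    isLocalization_away_sections_of_eq ⟨f ⁻¹ᵁ (U : S.Opens), U.2.preimage f⟩
      (f.app (U : S.Opens) g) _ (Scheme.preimage_basicOpen f g).symm
  haveI : IsLocalization (Algebra.algebraMapSubmonoid Γ(X, f ⁻¹ᵁ (U : S.Opens))
      (Submonoid.powers g)) Γ(X, f ⁻¹ᵁ S.basicOpen g) := by
    rw [Algebra.algebraMapSubmonoid, Submonoid.map_powers]
    exact hloc
  haveI : IsLocalization.Away g Γ(S, S.basicOpen g) := U.2.isLocalization_basicOpen g
  exact Module.fittingIdeal_of_isLocalizedModule (Submonoid.powers g) Γ(S, S.basicOpen g)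
    (IsScalarTower.toAlgHom Γ(S, U) Γ(X, f ⁻¹ᵁ (U : S.Opens)) Γ(X, f ⁻¹ᵁ S.basicOpen g)).toLinearMap r

/-- **The `r`-th Fitting ideal sheaf `Fit_r(f_*𝒪_X)` of a finite morphism `f : X → S`**: the
quasi-coherent ideal sheaf of `𝒪_S` whose sections over an affine open `U` form the `r`-th
Fitting ideal of the finite `Γ(S, U)`-module `Γ(X, f⁻¹U)` (Stacks 0C3C: the Fitting ideals of
the finite type quasi-coherent module `f_*𝒪_X`). [cite: StacksProject, Tag 0C3C] -/
def _root_.AlgebraicGeometry.Scheme.Hom.fittingIdealSheaf {X S : Scheme.{u}} (f : X.Hom S)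
    [IsFinite f] (r : ℕ) : S.IdealSheafData where
  ideal U := letI := (f.app (U : S.Opens)).hom.toAlgebra;
    Module.fittingIdeal Γ(S, U) Γ(X, f ⁻¹ᵁ (U : S.Opens)) r
  map_ideal_basicOpen U g := (fittingIdeal_sections_basicOpen f U g r).symm

/-- The ideal of sections of `Fit_r(f_*𝒪_X)` over an affine open. [cite: StacksProject, Tag 0C3C] -/
theorem fittingIdealSheaf_ideal (r : ℕ) (U : S.affineOpens) :
    (f.fittingIdealSheaf r).ideal U = (letI := (f.app (U : S.Opens)).hom.toAlgebra;
      Module.fittingIdeal Γ(S, U) Γ(X, f ⁻¹ᵁ (U : S.Opens)) r) := rfl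

/-- The Fitting ideal sheaves increase with `r`. [cite: StacksProject, Tag 07ZA] -/
theorem fittingIdealSheaf_mono {r r' : ℕ} (h : r ≤ r') :
    f.fittingIdealSheaf r ≤ f.fittingIdealSheaf r' := fun U => by
  letI := (f.app (U : S.Opens)).hom.toAlgebra
  exact Module.fittingIdeal_mono h

end Sheaf

end Literature.AlgebraicGeometry.Morphisms

end
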